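import Summits.ValiantsHypothesis.ValiantsHypothesis.Theorems.LangWeilTransferTransferGluePrimes

/-!
# LangWeilTransfer, crux `TameTransfer` (stmt-ValiantsHypothesis-6373), line `birth` —
# stub `stub_primeSupply` PROVED

Registered stub of the birth skeleton `Cruxes/TameTransfer/Lines/birth.lean` (namespace
`Summit.ValiantsHypothesis.ValiantsHypothesis.Cruxes.TameTransfer.Birth`): a Chebyshev prime supply —
for all `T, L` there are more than `2^L` primes `p` with `2^T < p ≤ 2^{c(T+L+1)}`; here `c = 10`,
from the tree's `π(2^μ)·μ ≥ 2^{μ-1}` (`two_pow_le_mul_primeCounting`, Mathlib `Chebyshev.pi_ge`).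
Honest framing: bookkeeping inside a dormant route; nothing here bears on VP ≠ VNP.
-/

-- the summit and the problem share the name `ValiantsHypothesis` (D-0017 single-conjunct layout)
set_option linter.dupNamespace false

namespace Summit.ValiantsHypothesis.ValiantsHypothesis.Theorems.LangWeilTransfer

/-- **Stub `stub_primeSupply` of crux `TameTransfer`, line `birth`** (signature verbatim, `c = 10`):
more than `2^L` primes in `(2^T, 2^{10(T+L+1)}]`. -/
theorem stub_primeSupply :
    ∃ c : ℕ, ∀ (T L : ℕ), ∃ P : Finset ℕ, 2 ^ L < P.card ∧
      ∀ p ∈ P, p.Prime ∧ 2 ^ T < p ∧ p ≤ 2 ^ (c * (T + L + 1)) := by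
  classical
  refine ⟨10, fun T L => ?_⟩
  set ℓ := T + L + 2 with hℓ
  set μ := 2 * ℓ + 6 with hμ
  have hμ3 : 3 ≤ μ := by omega
  -- `π(2^μ) ≥ 2^T + 2^L + 2`
  have hn : 2 ^ T + 2 ^ L + 2 ≤ 2 ^ ℓ := by
    have h1 : 2 ^ T ≤ 2 ^ (T + L) := Nat.pow_le_pow_right two_pos (by omega)
    have h2 : 2 ^ L ≤ 2 ^ (T + L) := Nat.pow_le_pow_right two_pos (by omega)
    have h3 : 2 ≤ 2 ^ (T + L + 1) := by
      calc 2 = 2 ^ 1 := (pow_one 2).symm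
        _ ≤ 2 ^ (T + L + 1) := Nat.pow_le_pow_right two_pos (by omega)
    have h4 : 2 ^ ℓ = 2 ^ (T + L) * 2 * 2 := by rw [hℓ, pow_succ, pow_succ]
    have h5 : 2 ^ (T + L + 1) = 2 ^ (T + L) * 2 := by rw [pow_succ]
    omega
  have hπ : 2 ^ T + 2 ^ L + 2 ≤ Nat.primeCounting (2 ^ μ) := by
    have hkey : μ * (2 ^ T + 2 ^ L + 2) ≤ μ * Nat.primeCounting (2 ^ μ) := by
      calc μ * (2 ^ T + 2 ^ L + 2) ≤ (2 * ℓ + 6) * 2 ^ ℓ := Nat.mul_le_mul_left _ hn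
        _ ≤ (2 * ℓ + 6) * 2 ^ (ℓ + 1) :=
            Nat.mul_le_mul_left _ (Nat.pow_le_pow_right two_pos (by omega))
        _ ≤ 2 ^ (2 * ℓ + 5) := aux_pow_bound ℓ
        _ = 2 ^ (μ - 1) := by rw [hμ]; congr 1
        _ ≤ μ * Nat.primeCounting (2 ^ μ) := two_pow_le_mul_primeCounting hμ3
    exact Nat.le_of_mul_le_mul_left hkey (by omega)
  -- the supply: primes in `(2^T, 2^μ]`
  set All := (Finset.range (2 ^ μ + 1)).filter Nat.Prime with hAll
  have hAllcard : All.card = Nat.primeCounting (2 ^ μ) := by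
    rw [hAll, Nat.primeCounting, Nat.primeCounting', Nat.count_eq_card_filter_range]
  set P := All.filter (fun p => 2 ^ T < p) with hP
  refine ⟨P, ?_, fun p hp => ?_⟩
  · -- counting: `All ⊆ P ∪ range (2^T + 1)`
    have hsub : All ⊆ P ∪ Finset.range (2 ^ T + 1) := by
      intro p hp
      rw [Finset.mem_union, hP, Finset.mem_filter, Finset.mem_range]
      by_cases h : 2 ^ T < p
      · exact Or.inl ⟨hp, h⟩
      · exact Or.inr (by omega)
    have hcard := (Finset.card_le_card hsub).trans (Finset.card_union_le _ _)
    rw [Finset.card_range, hAllcard] at hcard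
    omega
  · rw [hP, Finset.mem_filter, hAll, Finset.mem_filter, Finset.mem_range] at hp
    refine ⟨hp.1.2, hp.2, ?_⟩
    calc p ≤ 2 ^ μ := by omega
      _ ≤ 2 ^ (10 * (T + L + 1)) := Nat.pow_le_pow_right two_pos (by omega)

end Summit.ValiantsHypothesis.ValiantsHypothesis.Theorems.LangWeilTransfer
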